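import Summits.Ventures.Crystal3D.Bulk.HullRotSysEuler
import Summits.Ventures.Crystal3D.Bulk.GapHullRotation
import Summits.Ventures.Crystal3D.Bulk.RotSysEuler
import Summits.Ventures.Crystal3D.Bulk.GapOrientedFaces
import HarnessLib

/-!
# (G3), combinatorial half: the oriented tight map of a GAP configuration is the sub-rotation-
# system of the hull rotation system induced on the tight darts, and EULER'S RELATION
# `2V′ − #darts + 2F° = 4k` for it is a kernel theorem (`phase2/LEAN-FACES-DESIGN.md` §5.3)

HONEST FRAMING. Part of the venture `Summits/Ventures/Crystal3D` (cell `pub-crystal3d`, phase 2;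
seat p3). Kernel theorems about an admissible fourteen-ball configuration `c` (`IsGapConfig c`,
`intruderDist c < 3/2`); nothing here asserts anything about GAP(1.26), and CONNECTEDNESS
(`k = 1`, P-L3(b) L1) is NOT proved — the component count `k` stays in the statement. Assembly of
three kernel pieces: typer-bulk-2's generic (G1) (`RotSys.IsRotSys.chi2_eq_of_subset`:
sub-rotation-systems of planar rotation systems are planar), p3's (G2) (the hull fan
triangulation of `dirSet c` is a planar rotation system, `HullRotSys.chi2_univ_eq_numK`) and the
geometric half of (G3) (`IsGapConfig.hullSucc_firstReturn_onextNbr`: the first return of the hull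
rotation to the tight darts is `onextNbr`):

* `dirPair c q = (gapDir c q.1, gapDir c q.2)` (injective on `darts c`), `tightDartsH c` — the
  tight darts inside the dart type `↥(hullDarts (dirSet c))`, `α`-closed;
  `IsGapConfig.hullRot` — the hull rotation `σ_H` of `dirSet c` as a permutation;
* **`IsGapConfig.induce_hullRot_val`** — the induced rotation on the tight darts IS `onextNbr`;
  **`IsGapConfig.phi_hullRot_val`** — its face permutation IS `ofaceSucc` (`φ°`), hence
  `sameCycle_phi_iff_ofaceOf` (same face cycle ⇔ same oriented face `ofaceOf`);
* the counts of the induced system: `numV = #activeVertices c`, `#tightDartsH = #darts c`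
  (`= 2·tightCount c`), `numF = onumFaces c`;
* **`IsGapConfig.oriented_euler`**:
  `2·#activeVertices c − #darts c + 2·onumFaces c = 4·k`, `k = RotSys.numK` (the number of
  connected components of the oriented tight map) — Euler's relation `V′ − E + F° = 2k` for the
  DRAWN tight map, in the kernel.
-/

noncomputable section

namespace Summit.Ventures.Crystal3D

open Literature.Geometry.DiscreteGeometry Finset Equiv HullRotSys

variable {c : Fin 14 → EuclideanSpace ℝ (Fin 3)}

/-! ## Transport of darts to direction pairs -/

/-- The pair of directions of an index pair. -/
def dirPair (c : Fin 14 → EuclideanSpace ℝ (Fin 3)) (q : Fin 14 × Fin 14) :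
    EuclideanSpace ℝ (Fin 3) × EuclideanSpace ℝ (Fin 3) :=
  (gapDir c q.1, gapDir c q.2)

/-- `dirPair` commutes with reversal. -/
theorem dirPair_swap (c : Fin 14 → EuclideanSpace ℝ (Fin 3)) (q : Fin 14 × Fin 14) :
    dirPair c q.swap = (dirPair c q).swap := rfl

/-- Nonzero labels with equal directions are equal (window `D < 2`). -/
theorem IsGapConfig.eq_of_gapDir_eq (hc : IsGapConfig c) (hD2 : intruderDist c < 2) {j k : Fin 14}
    (hj : j ≠ 0) (hk : k ≠ 0) (h : gapDir c j = gapDir c k) : j = k := by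
  by_contra hjk
  exact hc.gapDir_ne hD2 hj hk hjk h

/-- `dirPair` is injective on the darts (window `D < 2`). -/
theorem IsGapConfig.dirPair_injOn (hc : IsGapConfig c) (hD2 : intruderDist c < 2) :
    Set.InjOn (dirPair c) (darts c : Set (Fin 14 × Fin 14)) := by
  intro q hq q' hq' h
  rw [Finset.mem_coe, mem_darts] at hq hq'
  simp only [dirPair, Prod.mk.injEq] at h
  exact Prod.ext (hc.eq_of_gapDir_eq hD2 hq.1 hq'.1 h.1) (hc.eq_of_gapDir_eq hD2 hq.2.1 hq'.2.1 h.2)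

/-- A tight dart is a hull dart of the direction set. -/
theorem IsGapConfig.dirPair_mem_hullDarts (hc : IsGapConfig c) (hD : intruderDist c < 3 / 2)
    {q : Fin 14 × Fin 14} (hq : q ∈ darts c) : dirPair c q ∈ hullDarts (dirSet c) :=
  hc.mk_mem_hullDarts_of_tight hD (mem_darts.1 hq).1 (snd_mem_tightNbrs_of_mem_darts hq)

/-- **The tight darts inside the dart type of the hull rotation system.** -/
def tightDartsH (c : Fin 14 → EuclideanSpace ℝ (Fin 3)) : Finset ↥(hullDarts (dirSet c)) :=
  univ.filter fun d => d.1 ∈ (darts c).image (dirPair c)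

/-- Membership in `tightDartsH`. -/
theorem mem_tightDartsH {d : ↥(hullDarts (dirSet c))} :
    d ∈ tightDartsH c ↔ ∃ q ∈ darts c, dirPair c q = d.1 := by
  unfold tightDartsH
  rw [mem_filter, mem_image]
  simp only [mem_univ, true_and]

/-- The tight darts are closed under reversal. -/
theorem isClosed_tightDartsH (c : Fin 14 → EuclideanSpace ℝ (Fin 3)) :
    RotSys.IsClosed (inv (dirSet c)) (tightDartsH c) := by
  intro d hd
  obtain ⟨q, hq, hqd⟩ := mem_tightDartsH.1 hd
  exact mem_tightDartsH.2 ⟨q.swap, swap_mem_darts hq, by rw [dirPair_swap, hqd]; rfl⟩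

/-- **The hull rotation `σ_H` of the direction set** as a permutation of its dart type. -/
def IsGapConfig.hullRot (hc : IsGapConfig c) : Perm ↥(hullDarts (dirSet c)) :=
  rot hc.norm_of_mem_dirSet hc.zero_mem_interior_convexHull_dirSet

/-! ## The induced rotation on the tight darts is `onextNbr`; its faces are the oriented faces -/

/-- **The rotation induced on the tight darts IS the oriented tight rotation**: for a tight dart
`d ↦ (i, j)`, `induce σ_H (tight darts) d ↦ (i, onextNbr c i j)`. -/
theorem IsGapConfig.induce_hullRot_val (hc : IsGapConfig c) (hD : intruderDist c < 3 / 2)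
    {q : Fin 14 × Fin 14} (hq : q ∈ darts c) {d : ↥(hullDarts (dirSet c))}
    (hd : d.1 = dirPair c q) :
    (RotSys.induce hc.hullRot (tightDartsH c) d).1 = dirPair c (q.1, onextNbr c q.1 q.2) := by
  have hD2 : intruderDist c < 2 := by linarith
  have hD3 := hc.sq_lt_three_of_lt hD
  obtain ⟨hi0, hj0, hij, -⟩ := mem_darts.1 hq
  have hj : q.2 ∈ tightNbrs c q.1 := snd_mem_tightNbrs_of_mem_darts hq
  obtain ⟨n, hn0, hit, hmin⟩ := hc.hullSucc_firstReturn_onextNbr hD hi0 hj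
  have hq' : (q.1, onextNbr c q.1 q.2) ∈ darts c := mk_mem_darts hi0 (hc.onextNbr_mem hD3 hi0 hj)
  set d' : ↥(hullDarts (dirSet c)) := ⟨dirPair c (q.1, onextNbr c q.1 q.2),
    hc.dirPair_mem_hullDarts hD hq'⟩ with hd'
  have hdT : d ∈ tightDartsH c := mem_tightDartsH.2 ⟨q, hq, hd.symm⟩
  have hd'T : d' ∈ tightDartsH c := mem_tightDartsH.2 ⟨_, hq', rfl⟩
  have hpow : (hc.hullRot ^ n) d = d' := by
    apply Subtype.ext
    unfold IsGapConfig.hullRot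
    rw [rot_pow_apply_val, hd]
    exact hit
  have hnot : ∀ m, 0 < m → m < n → (hc.hullRot ^ m) d ∉ tightDartsH c := by
    intro m hm0 hmn hmem
    obtain ⟨q', hq'd, hq'e⟩ := mem_tightDartsH.1 hmem
    unfold IsGapConfig.hullRot at hq'e
    rw [rot_pow_apply_val, hd] at hq'e
    -- the tail of the iterate is `gapDir c q.1`, so `q'.1 = q.1` and the head is a tight direction
    have hfst : gapDir c q'.1 = gapDir c q.1 := by
      have := congrArg Prod.fst hq'e
      rw [iterate_hullSucc_fst] at this
      exact this
    have hq'1 : q'.1 = q.1 := hc.eq_of_gapDir_eq hD2 (mem_darts.1 hq'd).1 hi0 hfst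
    apply hmin m hm0 hmn
    have hq'e' : (hullSucc (dirSet c))^[m] (gapDir c q.1, gapDir c q.2) = dirPair c q' :=
      hq'e.symm
    rw [hq'e']
    exact mem_image.2 ⟨q'.2, hq'1 ▸ snd_mem_tightNbrs_of_mem_darts hq'd, rfl⟩
  have h := RotSys.induce_eq_of_first_return hc.hullRot hdT hn0 hpow hd'T hnot
  rw [h]

/-- **The induced face permutation IS the oriented face successor `φ°`**: for a tight dart
`d ↦ q`, `phi σ_H (tight darts) d ↦ ofaceSucc c q`. -/
theorem IsGapConfig.phi_hullRot_val (hc : IsGapConfig c) (hD : intruderDist c < 3 / 2)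
    {q : Fin 14 × Fin 14} (hq : q ∈ darts c) {d : ↥(hullDarts (dirSet c))}
    (hd : d.1 = dirPair c q) :
    (RotSys.phi hc.hullRot (inv (dirSet c)) (tightDartsH c) d).1 = dirPair c (ofaceSucc c q) := by
  rw [RotSys.phi_apply]
  have hd' : (inv (dirSet c) d).1 = dirPair c q.swap := by
    rw [inv_apply_val, hd, dirPair_swap]
  rw [hc.induce_hullRot_val hD (swap_mem_darts hq) hd']
  rfl

/-- Iterates: `phi^n d ↦ φ°^[n] q`. -/
theorem IsGapConfig.phi_pow_hullRot_val (hc : IsGapConfig c) (hD : intruderDist c < 3 / 2)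
    {q : Fin 14 × Fin 14} (hq : q ∈ darts c) {d : ↥(hullDarts (dirSet c))}
    (hd : d.1 = dirPair c q) (n : ℕ) :
    ((RotSys.phi hc.hullRot (inv (dirSet c)) (tightDartsH c) ^ n) d).1 =
      dirPair c ((ofaceSucc c)^[n] q) := by
  induction n with
  | zero => exact hd
  | succ n ih =>
    rw [pow_succ', Perm.mul_apply, Function.iterate_succ_apply']
    exact hc.phi_hullRot_val hD
      (hc.iterate_ofaceSucc_mem_darts (hc.sq_lt_three_of_lt hD) hq n) ih

/-- **Same face cycle ⇔ same oriented face.** -/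
theorem IsGapConfig.sameCycle_phi_iff_ofaceOf (hc : IsGapConfig c) (hD : intruderDist c < 3 / 2)
    {q q' : Fin 14 × Fin 14} (hq : q ∈ darts c) (hq' : q' ∈ darts c)
    {d d' : ↥(hullDarts (dirSet c))} (hd : d.1 = dirPair c q) (hd' : d'.1 = dirPair c q') :
    (RotSys.phi hc.hullRot (inv (dirSet c)) (tightDartsH c)).SameCycle d d' ↔
      ofaceOf c q = ofaceOf c q' := by
  have hD2 : intruderDist c < 2 := by linarith
  have hD3 := hc.sq_lt_three_of_lt hD
  have hper := hc.mem_periodicPts_ofaceSucc hD3 hq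
  constructor
  · intro h
    obtain ⟨n, -, hn⟩ := h.exists_pow_eq'
    have hval := congrArg Subtype.val hn
    rw [hc.phi_pow_hullRot_val hD hq hd n, hd'] at hval
    have heq : (ofaceSucc c)^[n] q = q' :=
      hc.dirPair_injOn hD2 (Finset.mem_coe.2 (hc.iterate_ofaceSucc_mem_darts hD3 hq n))
        (Finset.mem_coe.2 hq') hval
    exact (ofaceOf_eq_of_mem hper ((mem_ofaceOf_iff hper).2 ⟨n, heq⟩)).symm
  · intro h
    have hmem : q' ∈ ofaceOf c q := by
      rw [h]; exact self_mem_ofaceOf (hc.mem_periodicPts_ofaceSucc hD3 hq')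
    obtain ⟨n, hn⟩ := (mem_ofaceOf_iff hper).1 hmem
    refine ⟨(n : ℤ), ?_⟩
    rw [zpow_natCast]
    apply Subtype.ext
    rw [hc.phi_pow_hullRot_val hD hq hd n, hn, hd']

/-! ## The counts of the induced system -/

/-- The number of tight darts in the dart type is the number of darts. -/
theorem IsGapConfig.card_tightDartsH (hc : IsGapConfig c) (hD : intruderDist c < 3 / 2) :
    (tightDartsH c).card = (darts c).card := by
  have hD2 : intruderDist c < 2 := by linarith
  have himg : (tightDartsH c).image Subtype.val = (darts c).image (dirPair c) := by
    ext p
    rw [mem_image, mem_image]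
    constructor
    · rintro ⟨d, hd, rfl⟩
      obtain ⟨q, hq, hqd⟩ := mem_tightDartsH.1 hd
      exact ⟨q, hq, hqd⟩
    · rintro ⟨q, hq, rfl⟩
      exact ⟨⟨dirPair c q, hc.dirPair_mem_hullDarts hD hq⟩, mem_tightDartsH.2 ⟨q, hq, rfl⟩, rfl⟩
  rw [← card_image_of_injective (tightDartsH c) Subtype.val_injective, himg,
    card_image_of_injOn (hc.dirPair_injOn hD2)]

/-- The active vertices are the tails of the darts. -/
theorem image_fst_darts (c : Fin 14 → EuclideanSpace ℝ (Fin 3)) :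
    (darts c).image Prod.fst = activeVertices c := by
  ext i
  rw [mem_image, mem_activeVertices]
  constructor
  · rintro ⟨q, hq, rfl⟩
    exact ⟨(mem_darts.1 hq).1, ⟨q.2, snd_mem_tightNbrs_of_mem_darts hq⟩⟩
  · rintro ⟨hi0, j, hj⟩
    exact ⟨(i, j), mk_mem_darts hi0 hj, rfl⟩

/-- **`V = #activeVertices`** for the induced system. -/
theorem IsGapConfig.numV_tightDartsH (hc : IsGapConfig c) (hD : intruderDist c < 3 / 2) :
    RotSys.numV hc.hullRot (tightDartsH c) = (activeVertices c).card := by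
  classical
  have hD2 : intruderDist c < 2 := by linarith
  unfold RotSys.numV IsGapConfig.hullRot
  rw [numClasses_eq_card_image (fun d : ↥(hullDarts (dirSet c)) => d.1.1)
    (fun d _ d' _ => sameCycle_rot_iff d d')]
  have himg : (tightDartsH c).image (fun d : ↥(hullDarts (dirSet c)) => d.1.1) =
      ((darts c).image Prod.fst).image (gapDir c) := by
    ext y
    simp only [mem_image]
    constructor
    · rintro ⟨d, hd, rfl⟩
      obtain ⟨q, hq, hqd⟩ := mem_tightDartsH.1 hd
      exact ⟨q.1, ⟨q, hq, rfl⟩, by rw [← hqd]; rfl⟩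
    · rintro ⟨i, ⟨q, hq, rfl⟩, rfl⟩
      exact ⟨⟨dirPair c q, hc.dirPair_mem_hullDarts hD hq⟩, mem_tightDartsH.2 ⟨q, hq, rfl⟩, rfl⟩
  rw [himg, card_image_of_injOn, image_fst_darts]
  intro i hi i' hi' h
  rw [Finset.mem_coe, mem_image] at hi hi'
  obtain ⟨q, hq, rfl⟩ := hi
  obtain ⟨q', hq', rfl⟩ := hi'
  exact hc.eq_of_gapDir_eq hD2 (mem_darts.1 hq).1 (mem_darts.1 hq').1 h

/-- **`F = onumFaces`** for the induced system. -/
theorem IsGapConfig.numF_tightDartsH (hc : IsGapConfig c) (hD : intruderDist c < 3 / 2) :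
    RotSys.numF hc.hullRot (inv (dirSet c)) (tightDartsH c) = onumFaces c := by
  classical
  have hD2 : intruderDist c < 2 := by linarith
  -- the face label of a dart: the oriented face of its index pair
  set f : ↥(hullDarts (dirSet c)) → Finset (Fin 14 × Fin 14) := fun d =>
    if h : ∃ q ∈ darts c, dirPair c q = d.1 then ofaceOf c (Classical.choose h) else ∅ with hf
  have hfq : ∀ {q : Fin 14 × Fin 14} (hq : q ∈ darts c) {d : ↥(hullDarts (dirSet c))},
      dirPair c q = d.1 → f d = ofaceOf c q := by
    intro q hq d hd
    have h : ∃ q ∈ darts c, dirPair c q = d.1 := ⟨q, hq, hd⟩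
    have hval : f d = ofaceOf c (Classical.choose h) := by rw [hf]; exact dif_pos h
    obtain ⟨hq₀, hd₀⟩ := Classical.choose_spec h
    have heq : Classical.choose h = q :=
      hc.dirPair_injOn hD2 (Finset.mem_coe.2 hq₀) (Finset.mem_coe.2 hq) (hd₀.trans hd.symm)
    rw [hval, heq]
  unfold RotSys.numF
  rw [numClasses_eq_card_image f ?_]
  · unfold onumFaces ofaces
    congr 1
    ext F
    rw [mem_image, mem_image]
    constructor
    · rintro ⟨d, hd, rfl⟩
      obtain ⟨q, hq, hqd⟩ := mem_tightDartsH.1 hd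
      exact ⟨q, hq, (hfq hq hqd).symm⟩
    · rintro ⟨q, hq, rfl⟩
      exact ⟨⟨dirPair c q, hc.dirPair_mem_hullDarts hD hq⟩, mem_tightDartsH.2 ⟨q, hq, rfl⟩,
        hfq hq rfl⟩
  · intro d hd d' hd'
    obtain ⟨q, hq, hqd⟩ := mem_tightDartsH.1 hd
    obtain ⟨q', hq', hqd'⟩ := mem_tightDartsH.1 hd'
    rw [hfq hq hqd, hfq hq' hqd']
    exact hc.sameCycle_phi_iff_ofaceOf hD hq hq' hqd.symm hqd'.symm

/-! ## Euler's relation for the oriented tight map -/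

/-- **Euler's relation for the ORIENTED tight map of a GAP configuration, in the kernel.** For
an admissible configuration with `intruderDist c < 3/2`:
`2·#activeVertices c − #darts c + 2·onumFaces c = 4·k`, where `k` is the number of connected
components of the tight map (as the sub-rotation-system of the hull rotation system induced on
the tight darts) — i.e. `V′ − E + F° = 2k` with `#darts = 2E`. (Sub-rotation-systems of the
planar hull map are planar.) -/
theorem IsGapConfig.oriented_euler (hc : IsGapConfig c) (hD : intruderDist c < 3 / 2) :
    2 * ((activeVertices c).card : ℤ) - (darts c).card + 2 * (onumFaces c : ℤ) =
      4 * (RotSys.numK hc.hullRot (inv (dirSet c)) (tightDartsH c) : ℤ) := by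
  have hplanar := chi2_univ_eq_numK (hX1 := hc.norm_of_mem_dirSet)
    (h0 := hc.zero_mem_interior_convexHull_dirSet)
  have h := (isRotSys (hX1 := hc.norm_of_mem_dirSet)
    (h0 := hc.zero_mem_interior_convexHull_dirSet)).chi2_eq_of_subset
    (fun _ _ => mem_univ _) (isClosed_tightDartsH c) (subset_univ _) hplanar
  unfold RotSys.chi2 at h
  rw [← hc.numV_tightDartsH hD, ← hc.card_tightDartsH hD, ← hc.numF_tightDartsH hD]
  exact h

/-- The same with `#darts = 2·tightCount` (`V′ − E + F° = 2k` doubled). -/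
theorem IsGapConfig.oriented_euler' (hc : IsGapConfig c) (hD : intruderDist c < 3 / 2) :
    ((activeVertices c).card : ℤ) - tightCount c + onumFaces c =
      2 * (RotSys.numK hc.hullRot (inv (dirSet c)) (tightDartsH c) : ℤ) := by
  have h := hc.oriented_euler hD
  rw [card_darts] at h
  push_cast at h
  omega

end Summit.Ventures.Crystal3D
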